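import Literature.NumberTheory.EllipticCurves.KuriharaNumberKimCertificate
import Literature.NumberTheory.EllipticCurves.KatoKolyvaginPrimes
import Literature.NumberTheory.EllipticCurves.Selmer
import HarnessLib

/-!
# Kim's structure theorem, corank clause, NON-VANISHING direction (C.-H. Kim 2022, Thm. 1.9 (1) with Cor. 1.6)

Topic `NumberTheory/EllipticCurves`; namespace `Literature.NumberTheory.EllipticCurves`. One named
fact (`def … : Prop`, D-0014), the `p^k`-level corank companion of the mod-`p` rank certificate
`Kim2022_kuriharaNumber_certificate` (`KuriharaNumberKimCertificate`, whose module docstring holds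
the provenance audit of the Iwasawa-theoretic input, "Status of statement (3)", reused verbatim
here) and the converse of the UPPER direction `Kim2022_selmerCorank_le_of_kuriharaNumber_ne_zero`
(`KuriharaNumberKimStructure`, same hypotheses and normalisation). Consumed by the crux
`SelmerRankLB` of `BirchSwinnertonDyer` (stmt-BirchSwinnertonDyer-0131, line `kurihara_order`,
stub K: `Summits/BirchSwinnertonDyer/BirchSwinnertonDyer/Theorems/SelmerRankSelmerRankLBStubKimOrder.lean`,
`stub_kim_order_le_corank_of_facts`) — the only place where Selmer groups enter that line.

## The printed statements (C.-H. Kim, *The structure of Selmer groups …*, arXiv:2203.12159 =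
Amer. J. Math. (2026); held text)

* §1.2.2 (p. 5): `𝒫_k = {ℓ : (ℓ, Np) = 1, ℓ ≡ 1 (mod p^k), a_ℓ(E) ≡ ℓ + 1 (mod p^k)}`, `𝒩_k` the
  square-free products of primes in `𝒫_k`, `I_ℓ = (ℓ - 1, a_ℓ - ℓ - 1)ℤ_p`, `I_n = Σ_{ℓ ∣ n} I_ℓ`
  (tree: `Kato.IsKolyvaginPrime`, `Kato.IsKolyvaginProduct`, file `KatoKolyvaginPrimes`).
* §1.4.1–1.4.4 (p. 7): for `p ≥ 5`, `ρ̄` irreducible and the Manin constant prime to `p`, the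
  symbols `[r]⁺ ∈ ℤ_(p)` of `2π ∫₀^∞ f(r + iy) dy = [r]⁺ Ω⁺_E + [r]⁻ √-1 Ω⁻_E`, `Ω⁺_E` the Néron
  period of a global minimal model; `δ̃_n = Σ_{a ∈ (ℤ/n)ˣ} \overline{[a/n]⁺} Π_{ℓ ∣ n}
  \overline{log_{η_ℓ}(a)} ∈ ℤ_p/I_nℤ_p` for `n ∈ 𝒩₁`, "well-defined up to `(ℤ_p/I_nℤ_p)ˣ`. When
  `n ∈ 𝒩_k`, we write `δ̃_n^{(k)} = δ̃_n mod p^k ∈ ℤ/p^kℤ`. When `n = 1`, we have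
  `δ̃_1 = [0]⁺ = L(E,1)/Ω⁺_E`"; `ord(δ̃) = min{ν(n) : n ∈ 𝒩₁, δ̃_n ≠ 0}` (`= ∞` if all vanish).
* COROLLARY 1.6 (p. 6). "Let `E` be an elliptic curve over `ℚ` and `p ≥ 5` a prime such that
  `ρ̄` is surjective, and the Manin constant is prime to `p`. If [the `ord_𝔓`-identity of
  Thm. 1.4 (2), localized at `𝔓 = XΛ`] holds, then the collection of Kurihara numbers … does not vanish
  identically. In particular, if one of the following holds: `E` has good ordinary reduction at
  `p`, … then `δ̃` does not vanish identically." Followed by: "The Manin constant is not divisible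
  by a prime `p ≥ 3` if `E` has semi-stable reduction at `p` [Mazur 1978]. Thus, the Manin
  constant assumption is needed only when `E` has additive reduction at `p`."
* THEOREM 1.9 (p. 7). "Let `E` be an elliptic curve over `ℚ` and `p ≥ 5` a prime such that `ρ̄` is
  surjective and the Manin constant is prime to `p`. If `ord(δ̃) < ∞`, then
  (1) `cork_{ℤ_p} Sel(ℚ, E[p^∞]) = ord(δ̃)` …" (proof §5–§7: Mazur–Rubin Kolyvagin systems,
  Büyükboduk's `Λ`-adic rigidity Thm. 6.1, Kato's explicit reciprocity law in Kolyvagin-derived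
  form Thm. 3.13, Lemma 3.14 `ord(p^t · δ̃) = ord(δ̃)` (pp. 18–19)).
* Status of the Iwasawa-theoretic input (the `ord_𝔓`-identity of Thm. 1.4 (2) at `𝔓 = XΛ`) at a
  good ORDINARY `p ≥ 5` with `ρ̄` onto: a THEOREM in print — Kato 2004, Thm. 17.4 (3) with
  Burungale–Castella–Skinner 2025, Thm. 1.1.2 (b) (and Kato §17.13 for the passage between the two
  formulations); see `KuriharaNumberKimCertificate`, "Status of statement (3)", for the audit,
  including why the paper's own "[Kato, Skinner–Urban, Wan]" needs that replacement.

## The Lean statement and its normalisation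

HYPOTHESES. `ρ̄` surjective = `HasSurjectiveModNGaloisRep`; good ordinary =
`HasGoodReductionAtPrime ∧ p ∤ a_p`; "Manin constant prime to `p`" is automatic at a prime `p ≥ 5`
of GOOD reduction by the paper's own remark quoted above (for the optimal curve: Mazur 1978
Cor. 4.1 / Abbes–Ullmo 1996 Thm. A; transport inside the isogeny class under `E[p]` irreducible:
Greenberg–Vatsal 2000, Remark 3.4 — the chain of the named fact
`realPeriodRat_eq_unit_mul_plusPeriod`, file `ModularCurvePeriodRatio`) and is kept implicit
exactly as printed.
CONCLUSION. `ord(δ̃) = cork < ∞` gives a minimiser `n ∈ 𝒩₁` with `ν(n) = cork` and `δ̃_n ≠ 0` in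
`ℤ_p/I_nℤ_p`. If `n = 1`: `I_1 = 0`, `δ̃_1 = [0]⁺ ≠ 0` in `ℤ_(p)`, so `δ̃_1 mod p^k ≠ 0` for
`k = v_p([0]⁺) + 1 ≥ 1`, and `1 ∈ 𝒩_k`. If `n > 1`: `I_n = p^kℤ_p` with `1 ≤ k < ∞`
(`0 ≠ ℓ - 1 ∈ I_ℓ ⊆ pℤ_p` for `ℓ ∈ 𝒫₁`), each `ℓ ∣ n` has `I_ℓ ⊆ p^kℤ_p`, i.e. `n ∈ 𝒩_k`, and
`δ̃_n^{(k)} = δ̃_n mod p^k` is `δ̃_n` itself, non-zero. So: SOME `k ≥ 1`, `n ∈ 𝒩_k` with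
`ν(n) = cork`, `δ̃_n^{(k)} ≠ 0`.
PERIODS (as in `KuriharaNumberKimCertificate`, point 1). Kim's `[r]⁺ = re{∞,r}_f/Ω⁺_E` is
normalised by the Néron period `Ω⁺_E = W.realPeriodRat`; the tree's `ratPlusSymbol f r =
re{∞,r}_f/Ω⁺_f` by `Ω⁺_f = plusPeriod f`. The statement therefore carries the EXPLICIT hypothesis
`Ω(W) = u · Ω⁺_f`, `u ∈ ℚ`, `|u|_p = 1`; under it `ratPlusSymbol f r = u · [r]⁺` with both sides
`p`-integral, so for `ψ_ℓ = log_{η_ℓ} mod p^k` (a surjective homomorphism `(ℤ/ℓ)ˣ → ℤ/p^k`, as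
`p^k ∣ ℓ - 1`) `kuriharaNumber f (p^k) n ψ = ū · δ̃_n^{(k)}` with `ū ∈ (ℤ/p^k)ˣ`
(`ratModP_eq_toZModPow`), and "`δ̃_n^{(k)} ≠ 0`" is literally "`kuriharaNumber f (p^k) n ψ ≠ 0`".
DISCRETE LOGARITHMS. Non-vanishing for one surjective choice is non-vanishing for all
(`exists_units_kuriharaNumber_eq_mul`); the statement asks for some.
WEAKENINGS. `ν(n) ≤ cork` instead of `=`; the newform at any level `N` (for `IsNewformOf W f` it is
the conductor, Carayol; the symbols `[a/n]⁺_f` depend on `f` only, while `𝒫_k` is read with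
`N_E = W.conductorNorm ℤ` as printed). Weaker than print, never stronger.

Not here: the UPPER direction of Thm. 1.9 (1) (`δ̃_n ≠ 0 ⇒ cork ≤ ν(n)`), clauses (2)–(6), the
supersingular / multiplicative cases; no `_holds` (size XL: the whole paper plus Kato 2004 and
Burungale–Castella–Skinner 2025).

## References

* C.-H. Kim, arXiv:2203.12159 (Amer. J. Math.), Thm. 1.9 (1), Cor. 1.6, §1.2.2, §1.4.1–1.4.4,
  Lemma 3.14, Thm. 3.13 [Kim2022StructureSelmer].
* K. Kato, Astérisque 295 (2004), Thm. 17.4, §17.13 [Kato2004Asterisque].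
* A. Burungale, F. Castella, C. Skinner, IMRN 2025 rnaf082 = arXiv:2405.00270v2, Thm. 1.1.2 and
  Remark 1.1.3 (ii) [BurungaleCastellaSkinner2025].
* R. Greenberg, V. Vatsal, Invent. Math. 142 (2000), §3, Remark 3.4 [GreenbergVatsal2000];
  B. Mazur, Invent. Math. 44 (1978), Cor. 4.1 [Mazur1978].
-/

noncomputable section

open scoped MatrixGroups ModularForm Classical

open CongruenceSubgroup Literature.NumberTheory.EllipticCurves.ModularForms

namespace Literature.NumberTheory.EllipticCurves

/-- **Kim 2022, Thm. 1.9 (1) with Cor. 1.6 — the Kurihara numbers of an elliptic curve do not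
vanish identically at a good ordinary prime, first at a level `ν(n)` equal to (here: at most) the
`p^∞`-Selmer corank** (C.-H. Kim, arXiv:2203.12159 = Amer. J. Math.: "THEOREM 1.9. Let `E/ℚ` and
`p ≥ 5` be such that `ρ̄` is surjective and the Manin constant is prime to `p`. If `ord(δ̃) < ∞`,
then (1) `cork_{ℤ_p} Sel(ℚ, E[p^∞]) = ord(δ̃)`"; "COROLLARY 1.6. … if `E` has good ordinary
reduction at `p` … then `δ̃` does not vanish identically", the Iwasawa-theoretic input localised
at `XΛ` being a theorem there — Kato 2004 Thm. 17.4 (3) with Burungale–Castella–Skinner 2025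
Thm. 1.1.2 (b), audited in `KuriharaNumberKimCertificate`; the Manin hypothesis is automatic at
a good `p ≥ 5` by the paper's remark after Cor. 1.6, see the module docstring).
Let `W/ℚ` be globally minimal and elliptic, `p ≥ 5` a prime of good ORDINARY reduction
(`p ∤ a_p`) with `ρ̄_{E,p}` surjective, `f ∈ S₂(Γ₀(N))` the newform of `W`, and assume the
period transfer `Ω(W) = u · Ω⁺_f`, `u ∈ ℚ`, `|u|_p = 1` (it turns Kim's Néron-normalised
`δ̃_n^{(k)}` into `ū⁻¹ · kuriharaNumber f (p^k) n ψ`, `ū ∈ (ℤ/p^k)ˣ`; supplied under these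
hypotheses by `realPeriodRat_eq_unit_mul_plusPeriod`). Then there are a level `k ≥ 1`, a
square-free product `n ∈ 𝒩_k` of Kolyvagin primes (`Kato.IsKolyvaginProduct W p k n`: every
`ℓ ∣ n` prime with `ℓ ∤ N_E p`, `ℓ ≡ 1`, `a_ℓ ≡ ℓ + 1 (mod p^k)`) with
`ν(n) ≤ cork_{ℤ_p} Sel_{p^∞}(E/ℚ) = W.selmerCorank p`, and surjective discrete logarithms
`ψ_ℓ : (ℤ/ℓ)ˣ → ℤ/p^k` with `kuriharaNumber f (p^k) n ψ ≠ 0` (a minimiser `n` of `ord(δ̃) = cork`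
at the level `k` with `I_n = p^kℤ_p`, resp. `k = v_p([0]⁺) + 1` when `n = 1`; module docstring,
CONCLUSION). Weaker than print (`≤`, some `k`, some `ψ`, any level). Size XL; no `_holds`.
[cite: Kim2022StructureSelmer, Thm. 1.9 (1) (p. 7) and Cor. 1.6 (p. 6), §1.2.2, §1.4.1–1.4.4, Lemma 3.14; BurungaleCastellaSkinner2025, Thm. 1.1.2 (b); Kato2004Asterisque, Thm. 17.4 (3) and §17.13] -/
def Kim2022_exists_kuriharaNumber_ne_zero_of_selmerCorank : Prop :=
  ∀ (W : WeierstrassCurve ℚ) [W.IsElliptic] [W.IsGloballyMinimal] (p : ℕ) [Fact p.Prime],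
    5 ≤ p → W.HasGoodReductionAtPrime p → ¬ (p : ℤ) ∣ W.frobeniusTrace p →
    W.HasSurjectiveModNGaloisRep p →
    ∀ {N : ℕ} [NeZero N] (f : CuspForm (Gamma0 N) 2), IsNewformOf W f →
    (∃ u : ℚ, ‖(u : ℚ_[p])‖ = 1 ∧ W.realPeriodRat = u * plusPeriod f) →
    ∃ (k n : ℕ) (_ : NeZero n), 1 ≤ k ∧ Kato.IsKolyvaginProduct W p k n ∧
      n.primeFactors.card ≤ W.selmerCorank p ∧
      ∃ ψ : (ℓ : ℕ) → (ZMod ℓ)ˣ →* Multiplicative (ZMod (p ^ k)),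
        (∀ ℓ ∈ n.primeFactors, Function.Surjective (ψ ℓ)) ∧
        kuriharaNumber f (p ^ k) n ψ ≠ 0

end Literature.NumberTheory.EllipticCurves

end
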